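import Summits.CriticalPhenomena.PercolationContinuityZ3.Theorems.PercNearOneGluingAdditiveGluingGoodStepResidualGluedIH
import Summits.CriticalPhenomena.PercolationContinuityZ3.Theorems.PercNearOneGluingAdditiveGluingBlockKernelSwitch
import HarnessLib

/-! # Crux `PercNearOneGluing.AdditiveGluing` (stmt-CriticalPhenomena-4576) — the Q9 LINE, part I: the σ-engine over the FULL star
# (invested seat xfam-a; part II = `…Q9Line.lean`)

Lands `--supports stmt-CriticalPhenomena-4576`; no definitions, no named facts.  Everything is stated inline:
* `Q9(w, A, o, b)` ("Question 9 goodness"): for EVERY minimiser `a₀` of `μ_K(· ↔ b)` over `A` (`K` = `w` with the star of `o`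
  killed) and every selection `sel W ∈ A`,  `μ_w(a₀ ↔ b) ≤ μ_w(o ↔ b) + Σ_{W ∋ o, W ∩ A = ∅} μ_w(C(o) = W)·μ_w(sel W ↔ b in Wᶜ)`.
  It implies the skeleton's goodness (`goodStep24_good_of_engine`) and, unlike it, is PRESERVED by the σ-decomposition of the full
  star (seat note `Cruxes/AdditiveGluing/XfamA-Q9-residual.md` §2).
* `engineFull_core` / `engineFull`: the σ-engine of siege k24 (`goodStep24_engine_core`) with the low-only hypothesis removed.
* `q9Step_of_residualKernelQ9`: the inductive step of Q9 from the residual kernel `hres9` = the official residual kernel (bad block,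
  `|S| ≥ 2`, `4 ≤ A.card`, drift) WITH the Q9 induction hypothesis for every weighting with at most as many positive-degree vertices
  as the glued block graph; layers meeting `A` by Lemma 5 (`stub_gluingLemma5`), singleton bad layers by the Q9 hypothesis for `K`
  (initial segment + `blockKernel_of_designated`), good blocks by Lemma 5, `A.card ≤ 3` by the drift theorem, drift-free blocks by the IH leaf.
* `q9All_of_residualKernelQ9` (strong induction on the number of positive-degree vertices; NO base case is needed: an observer
  without low neighbours has only layers meeting `A`), `good_of_q9`, and `additiveGluing_of_residualKernelQ9 : hres9 → AdditiveGluing`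
  (the level-set composition of the skeleton `Lines/subuniform_dead_pocket_maximum.lean`, verbatim).
With `hres9` the residual may use the SWITCHING leaf (`blockKernel_of_designated` fed by the Q9 hypothesis for the glued block observed
from one of its own vertices), which numerically completes the leaf set at n ≤ 8 (seat note §4).
[cite: KozmaNitzan2024, §3.2 (Definition p. 12, Lemma 5 p. 13, Thms 4–5 pp. 12–14), Question 9 (p. 36)]
-/

namespace Summit.CriticalPhenomena.PercolationContinuityZ3.Theorems

open MeasureTheory Set
open Literature.Probability.LatticeModels (prodBernoulli)
open Literature.Probability.Percolation (BondConfig openConn openConnIn openGraph openCluster)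
open scoped BigOperators

noncomputable section
open Classical

section EngineFull

open Filter
open Literature.Probability.LatticeModels Literature.Probability.Percolation

variable {n : ℕ}

/-- **The σ-engine over the FULL star of the observer** (= `goodStep24_engine_core` without the hypothesis that the pairs
`o–a`, `a ∈ A`, have weight `0`): the branch inequality is now required for EVERY positive layer `S ∌ o` (layers meeting `A` are
discharged by Kozma–Nitzan's Lemma 5 in `q9Step_of_residualKernelQ9`).  The designated relay `a₀` is the same for all layers, which is why the
conclusion is DESIGNATED goodness `D_sel(w, o; a₀)` — Question 9's form when `a₀ = argmin_A μ_K(· ↔ b)`.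
[cite: KozmaNitzan2024, §3.2 (proofs of Thms 4–5, pp. 13–14)] -/
theorem engineFull_core (w p : Sym2 (Fin n) → unitInterval) (A : Finset (Fin n))
    (o b a₀ : Fin n) (sel : Finset (Fin n) → Fin n) (hb : b ∈ A) (ho : o ∉ A) (ha₀ : a₀ ∈ A)
    (hpo : ∀ o' x : Fin n, x ∉ ({o} : Finset (Fin n)) → p s(o', x) = w s(o', x))
    (hlaw : ∀ (S : Finset (Fin n)) (E : Set (BondConfig (Fin n))),
      (prodBernoulli p).real
          ({ω | ∀ x : Fin n, x ∈ S ↔ (x ∉ ({o} : Finset (Fin n)) ∧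
              ∃ o' ∈ ({o} : Finset (Fin n)), s(o', x) ∈ ω)} ∩
            {ω | ({e | e ∈ ω ∧ ∀ x ∈ e, x ∉ ({o} : Finset (Fin n))} ∪
              {e | (∀ x ∈ e, x ∈ S) ∧ ¬ e.IsDiag}) ∈ E}) =
        (prodBernoulli p).real
            {ω | ∀ x : Fin n, x ∈ S ↔ (x ∉ ({o} : Finset (Fin n)) ∧
              ∃ o' ∈ ({o} : Finset (Fin n)), s(o', x) ∈ ω)} *
          (prodBernoulli (fun e : Sym2 (Fin n) =>
            if (∀ x ∈ e, x ∈ S) ∧ ¬ e.IsDiag then 1 else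
              if (∃ x ∈ e, x ∈ ({o} : Finset (Fin n))) then 0 else w e)).real E)
    (hker : ∀ S : Finset (Fin n), o ∉ S → (∀ y ∈ S, w s(o, y) ≠ 0) →
      (prodBernoulli (fun e : Sym2 (Fin n) =>
          if (∀ x ∈ e, x ∈ S) ∧ ¬ e.IsDiag then 1 else
            if (∃ x ∈ e, x ∈ ({o} : Finset (Fin n))) then 0 else w e)).real (openConn a₀ b) ≤
        (prodBernoulli (fun e : Sym2 (Fin n) =>
            if (∀ x ∈ e, x ∈ S) ∧ ¬ e.IsDiag then 1 else
              if (∃ x ∈ e, x ∈ ({o} : Finset (Fin n))) then 0 else w e)).real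
            (⋃ s ∈ S, openConn s b)
          + ∑ W ∈ (Finset.univ : Finset (Finset (Fin n))).filter (fun W => o ∈ W ∧ Disjoint W A),
              (prodBernoulli (fun e : Sym2 (Fin n) =>
                  if (∀ x ∈ e, x ∈ S) ∧ ¬ e.IsDiag then 1 else
                    if (∃ x ∈ e, x ∈ ({o} : Finset (Fin n))) then 0 else w e)).real
                  {ω : BondConfig (Fin n) | ∀ x : Fin n, x ≠ o →
                    (x ∈ W ↔ ω ∈ ⋃ s ∈ S, openConn s x)}
                * (prodBernoulli w).real (openConnIn ((W : Set (Fin n))ᶜ) (sel W) b)) :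
    (prodBernoulli p).real (openConn a₀ b) ≤
      (prodBernoulli p).real (openConn o b)
        + ∑ W ∈ (Finset.univ : Finset (Finset (Fin n))).filter (fun W => o ∈ W ∧ Disjoint W A),
            (prodBernoulli p).real {ω : BondConfig (Fin n) | openCluster ω o = (W : Set (Fin n))}
              * (prodBernoulli w).real (openConnIn ((W : Set (Fin n))ᶜ) (sel W) b) := by
  have hbo : b ≠ o := fun h => ho (h ▸ hb)
  have ha₀o : a₀ ≠ o := fun h => ho (h ▸ ha₀)
  have hmemFl : ∀ W, W ∈ (Finset.univ : Finset (Finset (Fin n))).filter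
      (fun W => o ∈ W ∧ Disjoint W A) ↔ o ∈ W ∧ Disjoint W A := fun W => by simp
  -- geometry on a layer (the clique condition is vacuous for a singleton block)
  have hclique : ∀ ω : BondConfig (Fin n), ∀ o₁ ∈ ({o} : Finset (Fin n)),
      ∀ o₂ ∈ ({o} : Finset (Fin n)), o₁ ≠ o₂ → s(o₁, o₂) ∈ ω := by
    intro ω o₁ h₁ o₂ h₂ hne
    exact absurd ((Finset.mem_singleton.1 h₁).trans (Finset.mem_singleton.1 h₂).symm) hne
  -- factorisation of `μ(L_S ∩ F)` for an event `F` that is `Ψ_S⁻¹ F'` on `L_S`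
  have hfac : ∀ (S : Finset (Fin n)) (F F' : Set (BondConfig (Fin n))),
      (∀ ω : BondConfig (Fin n),
        (∀ x : Fin n, x ∈ S ↔ (x ∉ ({o} : Finset (Fin n)) ∧
          ∃ o' ∈ ({o} : Finset (Fin n)), s(o', x) ∈ ω)) →
        (ω ∈ F ↔ ({e | e ∈ ω ∧ ∀ x ∈ e, x ∉ ({o} : Finset (Fin n))} ∪
              {e | (∀ x ∈ e, x ∈ S) ∧ ¬ e.IsDiag}) ∈ F')) →
      (prodBernoulli p).real
          ({ω | ∀ x : Fin n, x ∈ S ↔ (x ∉ ({o} : Finset (Fin n)) ∧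
              ∃ o' ∈ ({o} : Finset (Fin n)), s(o', x) ∈ ω)} ∩ F) =
        (prodBernoulli p).real
            {ω | ∀ x : Fin n, x ∈ S ↔ (x ∉ ({o} : Finset (Fin n)) ∧
              ∃ o' ∈ ({o} : Finset (Fin n)), s(o', x) ∈ ω)} *
          (prodBernoulli (fun e : Sym2 (Fin n) =>
            if (∀ x ∈ e, x ∈ S) ∧ ¬ e.IsDiag then 1 else
              if (∃ x ∈ e, x ∈ ({o} : Finset (Fin n))) then 0 else w e)).real F' := by
    intro S F F' hFF'
    rw [← hlaw S F']
    congr 1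
    ext ω
    simp only [Set.mem_inter_iff, Set.mem_setOf_eq]
    exact ⟨fun h => ⟨h.1, (hFF' ω h.1).1 h.2⟩, fun h => ⟨h.1, (hFF' ω h.1).2 h.2⟩⟩
  -- (1) `μ(o ↔ b)` through the star
  have hob : (prodBernoulli p).real (openConn o b) =
      ∑ S : Finset (Fin n), (prodBernoulli p).real
          {ω | ∀ x : Fin n, x ∈ S ↔ (x ∉ ({o} : Finset (Fin n)) ∧
              ∃ o' ∈ ({o} : Finset (Fin n)), s(o', x) ∈ ω)} *
        (prodBernoulli (fun e : Sym2 (Fin n) =>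
            if (∀ x ∈ e, x ∈ S) ∧ ¬ e.IsDiag then 1 else
              if (∃ x ∈ e, x ∈ ({o} : Finset (Fin n))) then 0 else w e)).real
          (⋃ s ∈ S, openConn s b) := by
    rw [sigmaRec_partition p ({o} : Finset (Fin n))]
    refine Finset.sum_congr rfl fun S _ => hfac S _ _ fun ω hLω => ?_
    have h := (stub_sigmaGeometry n ({o} : Finset (Fin n)) S ω hLω (hclique ω)).1 {b}
      (by simp [hbo.symm])
    simpa only [Finset.set_biUnion_singleton] using h
  -- (2) `μ(a₀ ↔ b)` through the star
  have hab : (prodBernoulli p).real (openConn a₀ b) =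
      ∑ S : Finset (Fin n), (prodBernoulli p).real
          {ω | ∀ x : Fin n, x ∈ S ↔ (x ∉ ({o} : Finset (Fin n)) ∧
              ∃ o' ∈ ({o} : Finset (Fin n)), s(o', x) ∈ ω)} *
        (prodBernoulli (fun e : Sym2 (Fin n) =>
            if (∀ x ∈ e, x ∈ S) ∧ ¬ e.IsDiag then 1 else
              if (∃ x ∈ e, x ∈ ({o} : Finset (Fin n))) then 0 else w e)).real (openConn a₀ b) := by
    rw [sigmaRec_partition p ({o} : Finset (Fin n))]
    refine Finset.sum_congr rfl fun S _ => hfac S _ _ fun ω hLω => ?_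
    exact (stub_sigmaGeometry n ({o} : Finset (Fin n)) S ω hLω (hclique ω)).2 a₀ b
      (by simp [ha₀o]) (by simp [hbo])
  -- (3) `μ(C(o) = W)` through the star
  have hCW : ∀ W ∈ (Finset.univ : Finset (Finset (Fin n))).filter (fun W => o ∈ W ∧ Disjoint W A),
      (prodBernoulli p).real {ω : BondConfig (Fin n) | openCluster ω o = (W : Set (Fin n))} =
      ∑ S : Finset (Fin n), (prodBernoulli p).real
          {ω | ∀ x : Fin n, x ∈ S ↔ (x ∉ ({o} : Finset (Fin n)) ∧
              ∃ o' ∈ ({o} : Finset (Fin n)), s(o', x) ∈ ω)} *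
        (prodBernoulli (fun e : Sym2 (Fin n) =>
            if (∀ x ∈ e, x ∈ S) ∧ ¬ e.IsDiag then 1 else
              if (∃ x ∈ e, x ∈ ({o} : Finset (Fin n))) then 0 else w e)).real
          {ω : BondConfig (Fin n) | ∀ x : Fin n, x ≠ o → (x ∈ W ↔ ω ∈ ⋃ s ∈ S, openConn s x)} := by
    intro W hW
    rw [sigmaRec_partition p ({o} : Finset (Fin n))]
    refine Finset.sum_congr rfl fun S _ => hfac S _ _ fun ω hLω => ?_
    rw [Set.mem_setOf_eq, goodStep24_cluster_eq_iff ω o W ((hmemFl W).1 hW).1, Set.mem_setOf_eq]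
    refine forall_congr' fun x => ?_
    refine imp_congr_right fun hx => ?_
    have h := (stub_sigmaGeometry n ({o} : Finset (Fin n)) S ω hLω (hclique ω)).1 {x}
      (by simp [Ne.symm hx])
    simp only [Finset.set_biUnion_singleton] at h
    exact iff_congr Iff.rfl h
  -- positive layers are admissible
  have hpos : ∀ S : Finset (Fin n), (prodBernoulli p).real
      {ω | ∀ x : Fin n, x ∈ S ↔ (x ∉ ({o} : Finset (Fin n)) ∧
          ∃ o' ∈ ({o} : Finset (Fin n)), s(o', x) ∈ ω)} ≠ 0 →
      o ∉ S ∧ ∀ y ∈ S, w s(o, y) ≠ 0 := by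
    intro S hS
    have h := sigmaRec_posLayer w p ({o} : Finset (Fin n)) S hpo hS
    refine ⟨fun hoS => (h o hoS).1 (Finset.mem_singleton_self o), fun y hy => ?_⟩
    obtain ⟨-, o', ho', hne⟩ := h y hy
    rw [Finset.mem_singleton.1 ho'] at hne
    exact hne
  -- rewrite the pocket sum through the star and swap the sums
  have hsumC : ∑ W ∈ (Finset.univ : Finset (Finset (Fin n))).filter (fun W => o ∈ W ∧ Disjoint W A),
      (prodBernoulli p).real {ω : BondConfig (Fin n) | openCluster ω o = (W : Set (Fin n))}
        * (prodBernoulli w).real (openConnIn ((W : Set (Fin n))ᶜ) (sel W) b) =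
      ∑ S : Finset (Fin n), (prodBernoulli p).real
          {ω | ∀ x : Fin n, x ∈ S ↔ (x ∉ ({o} : Finset (Fin n)) ∧
              ∃ o' ∈ ({o} : Finset (Fin n)), s(o', x) ∈ ω)} *
        ∑ W ∈ (Finset.univ : Finset (Finset (Fin n))).filter (fun W => o ∈ W ∧ Disjoint W A),
          (prodBernoulli (fun e : Sym2 (Fin n) =>
              if (∀ x ∈ e, x ∈ S) ∧ ¬ e.IsDiag then 1 else
                if (∃ x ∈ e, x ∈ ({o} : Finset (Fin n))) then 0 else w e)).real
              {ω : BondConfig (Fin n) | ∀ x : Fin n, x ≠ o → (x ∈ W ↔ ω ∈ ⋃ s ∈ S, openConn s x)}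
            * (prodBernoulli w).real (openConnIn ((W : Set (Fin n))ᶜ) (sel W) b) := by
    have h1 : ∑ W ∈ (Finset.univ : Finset (Finset (Fin n))).filter (fun W => o ∈ W ∧ Disjoint W A),
        (prodBernoulli p).real {ω : BondConfig (Fin n) | openCluster ω o = (W : Set (Fin n))}
          * (prodBernoulli w).real (openConnIn ((W : Set (Fin n))ᶜ) (sel W) b) =
        ∑ W ∈ (Finset.univ : Finset (Finset (Fin n))).filter (fun W => o ∈ W ∧ Disjoint W A),
          ∑ S : Finset (Fin n), (prodBernoulli p).real
              {ω | ∀ x : Fin n, x ∈ S ↔ (x ∉ ({o} : Finset (Fin n)) ∧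
                  ∃ o' ∈ ({o} : Finset (Fin n)), s(o', x) ∈ ω)} *
            ((prodBernoulli (fun e : Sym2 (Fin n) =>
                if (∀ x ∈ e, x ∈ S) ∧ ¬ e.IsDiag then 1 else
                  if (∃ x ∈ e, x ∈ ({o} : Finset (Fin n))) then 0 else w e)).real
                {ω : BondConfig (Fin n) | ∀ x : Fin n, x ≠ o → (x ∈ W ↔ ω ∈ ⋃ s ∈ S, openConn s x)}
              * (prodBernoulli w).real (openConnIn ((W : Set (Fin n))ᶜ) (sel W) b)) := by
      refine Finset.sum_congr rfl fun W hW => ?_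
      rw [hCW W hW, Finset.sum_mul]
      refine Finset.sum_congr rfl fun S _ => ?_
      ring
    rw [h1, Finset.sum_comm]
    refine Finset.sum_congr rfl fun S _ => ?_
    rw [Finset.mul_sum]
  rw [hab, hob, hsumC, ← Finset.sum_add_distrib]
  refine Finset.sum_le_sum fun S _ => ?_
  rw [← mul_add]
  rcases eq_or_ne ((prodBernoulli p).real
      {ω | ∀ x : Fin n, x ∈ S ↔ (x ∉ ({o} : Finset (Fin n)) ∧
          ∃ o' ∈ ({o} : Finset (Fin n)), s(o', x) ∈ ω)}) 0 with h0 | h0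
  · rw [h0, zero_mul, zero_mul]
  · obtain ⟨hoS, hSw⟩ := hpos S h0
    exact mul_le_mul_of_nonneg_left (hker S hoS hSw) measureReal_nonneg

/-- The branch weighting of the full engine is the gluing along `S` of `K` = `w` with the star of `o` killed. [folklore] -/
theorem engineFull_branch_weight_eq (w : Sym2 (Fin n) → unitInterval) (S : Finset (Fin n)) (o : Fin n) :
    (fun e : Sym2 (Fin n) =>
      if (∀ x ∈ e, x ∈ S) ∧ ¬ e.IsDiag then 1 else
        if (∃ x ∈ e, x ∈ ({o} : Finset (Fin n))) then 0 else w e) =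
    (fun e : Sym2 (Fin n) =>
      if (∀ x ∈ e, x ∈ S) ∧ ¬ e.IsDiag then 1 else
        (fun e : Sym2 (Fin n) => if o ∈ e then (0 : unitInterval) else w e) e) := by
  funext e
  by_cases hS : (∀ x ∈ e, x ∈ S) ∧ ¬ e.IsDiag
  · simp only [if_pos hS]
  · simp only [if_neg hS]
    by_cases hoe : o ∈ e
    · have h1 : ∃ x ∈ e, x ∈ ({o} : Finset (Fin n)) := ⟨o, hoe, Finset.mem_singleton_self o⟩
      rw [if_pos h1, if_pos hoe]
    · have h1 : ¬ ∃ x ∈ e, x ∈ ({o} : Finset (Fin n)) := by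
        rintro ⟨x, hx, hxo⟩
        exact hoe (Finset.mem_singleton.1 hxo ▸ hx)
      rw [if_neg h1, if_neg hoe]

/-- **The full-star σ-engine**: for `b ∈ A ∌ o`, ANY `a₀ ∈ A` and a selection, the branch inequalities of all positive layers
`S ∌ o` of the star of `o` imply designated goodness `D_sel(w, o; a₀)`. [cite: KozmaNitzan2024, §3.2 (proofs of Thms 4–5, pp. 13–14)] -/
theorem engineFull (w : Sym2 (Fin n) → unitInterval) (A : Finset (Fin n)) (o b a₀ : Fin n)
    (sel : Finset (Fin n) → Fin n) (hb : b ∈ A) (ho : o ∉ A) (ha₀ : a₀ ∈ A)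
    (hker : ∀ S : Finset (Fin n), o ∉ S → (∀ y ∈ S, w s(o, y) ≠ 0) →
      (prodBernoulli (fun e : Sym2 (Fin n) =>
          if (∀ x ∈ e, x ∈ S) ∧ ¬ e.IsDiag then 1 else
            if (∃ x ∈ e, x ∈ ({o} : Finset (Fin n))) then 0 else w e)).real (openConn a₀ b) ≤
        (prodBernoulli (fun e : Sym2 (Fin n) =>
            if (∀ x ∈ e, x ∈ S) ∧ ¬ e.IsDiag then 1 else
              if (∃ x ∈ e, x ∈ ({o} : Finset (Fin n))) then 0 else w e)).real
            (⋃ s ∈ S, openConn s b)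
          + ∑ W ∈ (Finset.univ : Finset (Finset (Fin n))).filter (fun W => o ∈ W ∧ Disjoint W A),
              (prodBernoulli (fun e : Sym2 (Fin n) =>
                  if (∀ x ∈ e, x ∈ S) ∧ ¬ e.IsDiag then 1 else
                    if (∃ x ∈ e, x ∈ ({o} : Finset (Fin n))) then 0 else w e)).real
                  {ω : BondConfig (Fin n) | ∀ x : Fin n, x ≠ o →
                    (x ∈ W ↔ ω ∈ ⋃ s ∈ S, openConn s x)}
                * (prodBernoulli w).real (openConnIn ((W : Set (Fin n))ᶜ) (sel W) b)) :
    (prodBernoulli w).real (openConn a₀ b) ≤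
      (prodBernoulli w).real (openConn o b)
        + ∑ W ∈ (Finset.univ : Finset (Finset (Fin n))).filter (fun W => o ∈ W ∧ Disjoint W A),
            (prodBernoulli w).real {ω : BondConfig (Fin n) | openCluster ω o = (W : Set (Fin n))}
              * (prodBernoulli w).real (openConnIn ((W : Set (Fin n))ᶜ) (sel W) b) := by
  have hpo : ∀ o' x : Fin n, x ∉ ({o} : Finset (Fin n)) →
      (fun e : Sym2 (Fin n) =>
        if (∀ y ∈ e, y ∈ ({o} : Finset (Fin n))) ∧ ¬ e.IsDiag then 1 else w e) s(o', x) =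
        w s(o', x) := by
    intro o' x hx
    show (if (∀ y ∈ s(o', x), y ∈ ({o} : Finset (Fin n))) ∧ ¬ (s(o', x)).IsDiag
      then (1 : unitInterval) else w s(o', x)) = w s(o', x)
    rw [if_neg]
    rintro ⟨h, -⟩
    exact hx (h x (Sym2.mem_mk_right o' x))
  have core := engineFull_core w
    (fun e : Sym2 (Fin n) =>
      if (∀ y ∈ e, y ∈ ({o} : Finset (Fin n))) ∧ ¬ e.IsDiag then 1 else w e)
    A o b a₀ sel hb ho ha₀ hpo (fun S E => stub_sigmaLaw n w {o} S E) hker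
  rw [goodStep24_glue_singleton w o] at core
  exact core

end EngineFull

open Filter Literature.Probability.LatticeModels Literature.Probability.Percolation in
/-- Registered helper stub `stub_engineFull_xfa` (invested seat xfam-a): the σ-engine over the FULL star of the observer (= `engineFull`).
[cite: KozmaNitzan2024, §3.2 (proofs of Thms 4–5, pp. 13–14)] -/
theorem stub_engineFull_xfa : ∀ (n : ℕ) (w : Sym2 (Fin n) → unitInterval) (A : Finset (Fin n)) (o b a₀ : Fin n) (sel : Finset (Fin n) → Fin n), (b ∈ A) → (o ∉ A) → (a₀ ∈ A) → (∀ S : Finset (Fin n), o ∉ S → (∀ y ∈ S, w s(o, y) ≠ 0) → (prodBernoulli (fun e : Sym2 (Fin n) => if (∀ x ∈ e, x ∈ S) ∧ ¬ e.IsDiag then 1 else if (∃ x ∈ e, x ∈ ({o} : Finset (Fin n))) then 0 else w e)).real (openConn a₀ b) ≤ (prodBernoulli (fun e : Sym2 (Fin n) => if (∀ x ∈ e, x ∈ S) ∧ ¬ e.IsDiag then 1 else if (∃ x ∈ e, x ∈ ({o} : Finset (Fin n))) then 0 else w e)).real (⋃ s ∈ S, openConn s b) + ∑ W ∈ (Finset.univ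 : Finset (Finset (Fin n))).filter (fun W => o ∈ W ∧ Disjoint W A), (prodBernoulli (fun e : Sym2 (Fin n) => if (∀ x ∈ e, x ∈ S) ∧ ¬ e.IsDiag then 1 else if (∃ x ∈ e, x ∈ ({o} : Finset (Fin n))) then 0 else w e)).real {ω : BondConfig (Fin n) | ∀ x : Fin n, x ≠ o → (x ∈ W ↔ ω ∈ ⋃ s ∈ S, openConn s x)} * (prodBernoulli w).real (openConnIn ((W : Set (Fin n))ᶜ) (sel W) b)) → (prodBernoulli w).real (openConn a₀ b) ≤ (prodBernoulli w).real (openConn o b) + ∑ W ∈ (Finset.univ : Finset (Finset (Fin n))).filter (fun W => o ∈ W ∧ Disjoint W A), (prodBernoulli w).real {ω : BondConfig (Fin n) | openCluster ω o = (W : Set (Fin n))} * (prodBernoulli w).real (openConnIn ((W : Set (Fin n))ᶜ) (sel W) b) :=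
  fun _ w A o b a₀ sel hb ho ha₀ hker => engineFull w A o b a₀ sel hb ho ha₀ hker

end

end Summit.CriticalPhenomena.PercolationContinuityZ3.Theorems
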